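import Mathlib

/-!
# B13OpDatum — the OPERATOR DATUM of one step of [Balaban1988RG2Cluster] §2 as a normed space: weighted-entry formats on
# `ℓ^∞`, coordinate read-outs as bounded ℂ-linear functionals, the five B13 operator species and their entry weights
# (row O1-b of the NE5 O1 claim table, part 1 of 2; part 2 = `B13OpDatumJunctions`: data maps, row NE2's currency, route P2)

Cell `pub-balaban`, unit `b2b-balaban-t4-ne5-formalise-leaf-07` (NE5 formalisation swarm, LEAF PROVER 07; row **O1-b OPERATOR
DATUM** of `t4/b2b-balaban-t4-ne5-p1/O1-CLAIM-TABLE-NE5-P1.md`, design `B13StepDesign.md` v0.2 RULE R2 + Q1).  Summits-side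
NEW WORK under the LEAN PLACEMENT RULE (cell modelling + bookkeeping; NOT a Literature module; print is cited for KIND only;
pure Mathlib, no tree import).  HONEST FRAMING: rung (B)+1 of the FINITE-VOLUME T⁴ continuum programme — NOT infinite volume,
NOT a mass gap, NOT the Clay problem, NOT a proof of NE5 (NOT PRINTED: [Balaban1987RG1]–[Balaban1989LargeFieldII] print
ε-UNIFORM bounds, never η-RATES).  HONEST DEPENDENCY (cell, verbatim): continuum YM on T⁴ ⇐ BetaPertH ∧ nine spine estimates
(0/9 proved); BetaPertH ⇐ (D1) ∧ (D4) ∧ CAP+tail; G-an2-4 gates asym, D1 and NE2/3/4.  This file asserts NO estimate about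
Bałaban's objects; it TYPES the operator slot `Op` of `T4InputCauchyRateData.StepModel` ∕ of route P2's `TermDatum`.

WHAT THE STEP READS (design RULE R2, Q1 answered v0.2; loci `t4/b2b-balaban-t4-ne5-p1/b13-loci.md`).  A (2.14)-term of B13
p. 15 reads, at a localisation slot `t` (the term's `Z₀` and its `s∕σ`-resolution — instantiation data, a parameter type `T`),
five OPERATOR SPECIES (`Species`): the covariance `C^{(k)}(Z₀, σ)` of the `B`-Gaussian and of the normalisation (`cov`; route
P2's read-out `kP`), the kernel `A = C*Δ_k(σ)C` under the square root of `Γ_k = L·A^{−1/2}` (`deltaKer`; `kA`), the constituent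
`L` (`gammaConstituent`; `kL`), and the two potential read-outs of Lemma 2 (1.42) p. 11 — the quadratic-form kernel
`Q(Y, B; b, b′)` (`potQ`; `kQ`, may depend on the field argument `x`) and the operator part of `𝐕″_k(Y, ·)` (`potR`; `kR`).  The
square root, the determinant quotients (2.15)∕(2.17) and the contour variables are INSIDE the output functional (row O1-d).

HOW THE DATUM IS NORMED (the one decision made here).  B13 measures its kernels ENTRYWISE AGAINST DECAYING WEIGHTS — (1.7)
p. 3 *"exp(−δ₀d(ω, y, y′)) … This bound holds for all operator norms in formulations of theorems in [13]"*, (2.16) p. 16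
*"|R₁(b, b′)| ≤ (…)exp(−½δ₀|b₋ − b′₋|)"*, (1.43) p. 11 for `Q(Y, B, b, b′)`, (1.36) p. 9 ∕ (2.18) p. 16 for `𝐕″` — and route
P2's `ActivityTermReadouts.LinearReadouts.Calibrated` consumes exactly such ENTRY-WEIGHT FORMATS.  So: `OpDatum E := ℓ^∞(E, ℂ)`
(Mathlib's `lp (fun _ : E => ℂ) ∞`, a complex Banach space) of NORMALISED entries over an entry type `E`, with a `Format`
(`wt : E → ℝ`, `wt > 0`); the raw entry is `entry F o e = wt e · o e`; the norm is the weighted sup (`norm_le_iff_entry`: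
`‖o‖ ≤ R ↔ ∀ e, |entry F o e| ≤ R·wt e`); the coordinate read-out `entryCLM F e : OpDatum E →L[ℂ] ℂ` has operator norm `≤ wt e`
(`norm_entryCLM_le` — `Calibrated` with moduli `1`, part 2); a raw kernel `K` in the format ball of radius `R` (`InFormat F K R`,
the SHAPE of a one-run (1.7)∕(2.16)∕(1.43)-type bound) is packaged as `assemble F K` with `entry (assemble F K) = K` and
`‖assemble F K‖ ≤ R`; `assemble` is additive on format-bounded kernels (`assemble_sub`), so an ENTRYWISE two-run discrepancy
`|K e − K′ e| ≤ R·wt e` is a NORM discrepancy `≤ R` (`norm_assemble_sub_le`) — the liaison's (L1) NORM PACKAGING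
(`T4OperatorRateLiaison` §2, *"Op = normalised entries in the sup norm over a finite entry set"*) for an ARBITRARY entry set
(the potential species are indexed by the field argument).  An UNWEIGHTED uniform entry bound (what an operator-norm tower
increment gives) packages only with the loss `1 ∕ min wt` (`norm_assemble_sub_le_of_uniform`; part 2 says which row-NE2
currency therefore fits).  §2: the entry type `Species T κ ι Ω 𝒴`, the weights `B13Weights` (= the entry formats of P2's
`Calibrated`: `e^{−δd}`, `e^{−2δd}`, `e^{−2δd}`, `w(Y)k(b,b′)∕|τ(Y)|`, `v(Y)∕|τ(Y)|`) with `B13Weights.format`, and the record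
`RawSpecies` of one run's RAW kernels — THE NAMED PARAMETERS of an instantiation (the tree holds tower∕entry values only for the
covariance species at `U = 1`, row NE2; nothing yet for the other four at a background).  §3: a two-entry toy (non-vacuity).

WHAT IS *NOT* HERE.  No operator of Bałaban's is constructed or estimated; every `def` is data or a hypothesis SHAPE and every
theorem is bookkeeping (0 sorry).  The margin `rOp k` is a MODEL PARAMETER of the instantiation (design RULE R6; its existence
for Bałaban's step is leaf O2-op, NOT PRINTED — GAPS G-ne5p1-1′) and is not fixed here; which slots and index sets occur is row
O1-a∕O1-d's data; the readings are row O4-r's; the carriers are row O1-a's.  `FlowStep.BetaPertH`, (B), (B^μ) do not occur.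
-/

noncomputable section

open scoped BigOperators ENNReal

namespace Summit.QuantumFields.BalabanUV.T4Continuum.B13OpDatum

/-! ## §1 Weighted-entry formats and the operator-datum space `ℓ^∞(E, ℂ)` of normalised entries -/

/-- DATA (no inequality beyond positivity): an ENTRY-WEIGHT FORMAT on an entry type `E` — the printed majorant shape
against which a kernel entry is measured (B13 (1.7) p. 3, (2.16) p. 16, (1.43) p. 11: decaying exponential weights; KIND
only). [folklore] -/
structure Format (E : Type*) where
  /-- the weight of entry `e` (e.g. `e^{−δ d(b, b′)}`) -/
  wt : E → ℝ
  /-- weights are positive -/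
  wt_pos : ∀ e, 0 < wt e

/-- THE OPERATOR-DATUM SPACE over the entry type `E`: bounded ℂ-valued families of NORMALISED entries with the sup norm
(Mathlib's `ℓ^∞`, a complex Banach space).  The liaison's (L1) norm packaging for an arbitrary entry set. [folklore] -/
abbrev OpDatum (E : Type*) : Type _ := lp (fun _ : E => ℂ) ∞

section Generic

variable {E : Type*} (F : Format E)

namespace Format

/-- [folklore] Weights are nonzero. -/
theorem wt_ne_zero (e : E) : F.wt e ≠ 0 := (F.wt_pos e).ne'

/-- [folklore] The norm of a weight cast to `ℂ` is the weight. -/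
theorem norm_wt (e : E) : ‖(F.wt e : ℂ)‖ = F.wt e := by
  rw [Complex.norm_real, Real.norm_eq_abs, abs_of_pos (F.wt_pos e)]

end Format

/-- The coordinate evaluation `o ↦ o e` as a bounded ℂ-linear functional (operator norm `≤ 1`). [folklore] -/
def evalCLM (e : E) : OpDatum E →L[ℂ] ℂ :=
  LinearMap.mkContinuous
    { toFun := fun o => o e
      map_add' := fun o o' => by simp only [lp.coeFn_add, Pi.add_apply]
      map_smul' := fun c o => by simp only [lp.coeFn_smul, Pi.smul_apply, RingHom.id_apply] }
    1 (fun o => by rw [one_mul]; exact lp.norm_apply_le_norm ENNReal.top_ne_zero o e)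

/-- [folklore] `evalCLM e o = o e`. -/
@[simp] theorem evalCLM_apply (e : E) (o : OpDatum E) : evalCLM e o = o e := rfl

/-- [folklore] `‖evalCLM e‖ ≤ 1`. -/
theorem norm_evalCLM_le (e : E) : ‖(evalCLM e : OpDatum E →L[ℂ] ℂ)‖ ≤ 1 :=
  LinearMap.mkContinuous_norm_le _ zero_le_one _

/-- THE RAW ENTRY of a datum in the format `F`: `entry F o e = wt e · o e` (the datum stores `entry ∕ wt`). [folklore] -/
def entry (o : OpDatum E) (e : E) : ℂ := (F.wt e : ℂ) * o e

/-- THE COORDINATE READ-OUT of entry `e` as a bounded ℂ-linear functional: `wt e • evalCLM e`. [folklore] -/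
def entryCLM (e : E) : OpDatum E →L[ℂ] ℂ := (F.wt e : ℂ) • evalCLM e

/-- [folklore] `entryCLM F e o = entry F o e`. -/
@[simp] theorem entryCLM_apply (e : E) (o : OpDatum E) : entryCLM F e o = entry F o e := rfl

/-- [folklore] **CALIBRATION OF THE COORDINATE READ-OUTS**: `‖entryCLM F e‖ ≤ wt e` — the read-out of entry `e` has operator
norm at most its weight (this is `LinearReadouts.Calibrated` with modulus `1`, §4). -/
theorem norm_entryCLM_le (e : E) : ‖entryCLM F e‖ ≤ F.wt e := by
  rw [entryCLM, norm_smul, F.norm_wt]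
  exact mul_le_of_le_one_right (F.wt_pos e).le (norm_evalCLM_le e)

/-- [folklore] Every raw entry is at most its weight times the norm: `|entry F o e| ≤ wt e · ‖o‖`. -/
theorem norm_entry_le (o : OpDatum E) (e : E) : ‖entry F o e‖ ≤ F.wt e * ‖o‖ := by
  rw [entry, norm_mul, F.norm_wt]
  exact mul_le_mul_of_nonneg_left (lp.norm_apply_le_norm ENNReal.top_ne_zero o e) (F.wt_pos e).le

/-- [folklore] **THE NORM IS THE WEIGHTED SUP OF THE RAW ENTRIES**: for `R ≥ 0`, `‖o‖ ≤ R ↔ ∀ e, |entry F o e| ≤ R · wt e`. -/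
theorem norm_le_iff_entry (o : OpDatum E) {R : ℝ} (hR : 0 ≤ R) : ‖o‖ ≤ R ↔ ∀ e, ‖entry F o e‖ ≤ R * F.wt e := by
  constructor
  · intro h e
    calc ‖entry F o e‖ ≤ F.wt e * ‖o‖ := norm_entry_le F o e
      _ ≤ F.wt e * R := mul_le_mul_of_nonneg_left h (F.wt_pos e).le
      _ = R * F.wt e := mul_comm _ _
  · intro h
    refine lp.norm_le_of_forall_le hR fun e => ?_
    have he := h e
    rw [entry, norm_mul, F.norm_wt, mul_comm] at he
    exact le_of_mul_le_mul_right he (F.wt_pos e)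

/-- [folklore] Entries in a common format determine the datum. -/
theorem ext_entry {o o' : OpDatum E} (h : ∀ e, entry F o e = entry F o' e) : o = o' := by
  refine lp.ext (funext fun e => ?_)
  have := h e
  simp only [entry] at this
  exact mul_left_cancel₀ (by exact_mod_cast F.wt_ne_zero e) this

/-- HYPOTHESIS SHAPE (the ONE-RUN FORMAT BOUND of a raw kernel; printed KIND for one run: B13 (1.7) p. 3, (2.16) p. 16,
(1.43) p. 11 — asserted nowhere): every entry of `K` is at most `R` times its weight. [folklore] -/
def InFormat (K : E → ℂ) (R : ℝ) : Prop := ∀ e, ‖K e‖ ≤ R * F.wt e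

/-- HYPOTHESIS SHAPE: the raw kernel lies in SOME format ball (what is needed to package it as a datum). [folklore] -/
def FormatBounded (K : E → ℂ) : Prop := ∃ R, InFormat F K R

variable {F}

/-- [folklore] A format bound is a `FormatBounded` witness. -/
theorem InFormat.formatBounded {K : E → ℂ} {R : ℝ} (h : InFormat F K R) : FormatBounded F K := ⟨R, h⟩

/-- [folklore] Format bounds are monotone in the radius. -/
theorem InFormat.mono {K : E → ℂ} {R R' : ℝ} (h : InFormat F K R) (hRR' : R ≤ R') : InFormat F K R' :=
  fun e => (h e).trans (mul_le_mul_of_nonneg_right hRR' (F.wt_pos e).le)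

/-- [folklore] Format bounds subtract: radii add. -/
theorem InFormat.sub {K K' : E → ℂ} {R R' : ℝ} (h : InFormat F K R) (h' : InFormat F K' R') :
    InFormat F (K - K') (R + R') := fun e =>
  calc ‖(K - K') e‖ = ‖K e - K' e‖ := rfl
    _ ≤ ‖K e‖ + ‖K' e‖ := norm_sub_le _ _
    _ ≤ R * F.wt e + R' * F.wt e := add_le_add (h e) (h' e)
    _ = (R + R') * F.wt e := by ring

/-- [folklore] `FormatBounded` is closed under subtraction. -/
theorem FormatBounded.sub {K K' : E → ℂ} (h : FormatBounded F K) (h' : FormatBounded F K') : FormatBounded F (K - K') := by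
  obtain ⟨R, hR⟩ := h
  obtain ⟨R', hR'⟩ := h'
  exact ⟨R + R', hR.sub hR'⟩

/-- [folklore] On a FINITE entry set every raw kernel is format-bounded (the unit-lattice Gaussian species over a fixed torus
have finitely many entries; only the field-dependent potential species need a genuine bound). -/
theorem formatBounded_of_finite [Finite E] (K : E → ℂ) : FormatBounded F K := by
  obtain ⟨R, hR⟩ := (Set.finite_range fun e => ‖K e‖ / F.wt e).bddAbove
  refine ⟨R, fun e => ?_⟩
  have h := hR ⟨e, rfl⟩
  rwa [div_le_iff₀ (F.wt_pos e)] at h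

/-- [folklore] A format-bounded kernel, divided by the weights, is a bounded family. -/
theorem memℓp_div_wt {K : E → ℂ} (h : FormatBounded F K) : Memℓp (fun e => K e / (F.wt e : ℂ)) ∞ := by
  obtain ⟨R, hR⟩ := h
  refine memℓp_infty ⟨R, ?_⟩
  rintro _ ⟨e, rfl⟩
  dsimp only
  rw [norm_div, F.norm_wt, div_le_iff₀ (F.wt_pos e)]
  exact hR e

variable (F)

open Classical in
/-- **PACKAGING A RAW KERNEL AS A DATUM**: `assemble F K` stores the normalised entries `K e ∕ wt e` when `K` is format-bounded,
and is the junk value `0` otherwise (documented junk: every use below carries the `FormatBounded` hypothesis). [folklore] -/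
def assemble (K : E → ℂ) : OpDatum E :=
  if h : FormatBounded F K then ⟨fun e => K e / (F.wt e : ℂ), memℓp_div_wt h⟩ else 0

variable {F}

/-- [folklore] The stored (normalised) entries of an assembled kernel. -/
theorem assemble_apply {K : E → ℂ} (h : FormatBounded F K) (e : E) : assemble F K e = K e / (F.wt e : ℂ) := by
  simp only [assemble, dif_pos h]

/-- [folklore] **The raw entries of an assembled kernel are the kernel**: `entry F (assemble F K) e = K e`. -/
theorem entry_assemble {K : E → ℂ} (h : FormatBounded F K) (e : E) : entry F (assemble F K) e = K e := by
  rw [entry, assemble_apply h, mul_div_cancel₀ _ (by exact_mod_cast F.wt_ne_zero e)]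

/-- [folklore] The coordinate read-out of an assembled kernel returns the raw entry. -/
theorem entryCLM_assemble {K : E → ℂ} (h : FormatBounded F K) (e : E) : entryCLM F e (assemble F K) = K e := by
  rw [entryCLM_apply, entry_assemble h]

/-- [folklore] **A format bound of radius `R ≥ 0` IS a norm bound of the datum**: `InFormat F K R → ‖assemble F K‖ ≤ R`. -/
theorem norm_assemble_le {K : E → ℂ} {R : ℝ} (hK : InFormat F K R) (hR : 0 ≤ R) : ‖assemble F K‖ ≤ R :=
  (norm_le_iff_entry F _ hR).2 fun e => by rw [entry_assemble hK.formatBounded]; exact hK e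

/-- [folklore] Conversely the norm of an assembled kernel bounds its entries in the format. -/
theorem inFormat_norm_assemble {K : E → ℂ} (h : FormatBounded F K) : InFormat F K ‖assemble F K‖ := fun e => by
  rw [← entry_assemble h e]; exact (norm_le_iff_entry F _ (norm_nonneg _)).1 le_rfl e

/-- [folklore] Every datum is the assembly of its own raw entries (the packaging loses nothing). -/
theorem assemble_entry (o : OpDatum E) : assemble F (entry F o) = o := by
  have hb : FormatBounded F (entry F o) := ⟨‖o‖, (norm_le_iff_entry F o (norm_nonneg _)).1 le_rfl⟩
  exact ext_entry F fun e => entry_assemble hb e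

/-- [folklore] **`assemble` IS ADDITIVE ON FORMAT-BOUNDED KERNELS**: the difference of two assembled kernels is the assembled
difference — so a two-run ENTRYWISE discrepancy bound is a NORM bound of the data discrepancy (`norm_assemble_sub_le`). -/
theorem assemble_sub {K K' : E → ℂ} (h : FormatBounded F K) (h' : FormatBounded F K') :
    assemble F K - assemble F K' = assemble F (K - K') := by
  refine ext_entry F fun e => ?_
  rw [entry_assemble (h.sub h'), entry, lp.coeFn_sub, Pi.sub_apply, mul_sub, ← entry, ← entry, entry_assemble h,
    entry_assemble h']
  rfl

/-- [folklore] **ENTRYWISE DISCREPANCY IN THE FORMAT ⇒ NORM DISCREPANCY**: if `|K e − K′ e| ≤ R·wt e` for every entry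
(`R ≥ 0`), then `‖assemble F K − assemble F K′‖ ≤ R`. -/
theorem norm_assemble_sub_le {K K' : E → ℂ} (h : FormatBounded F K) (h' : FormatBounded F K') {R : ℝ} (hR : 0 ≤ R)
    (hKK' : ∀ e, ‖K e - K' e‖ ≤ R * F.wt e) : ‖assemble F K - assemble F K'‖ ≤ R := by
  rw [assemble_sub h h']
  exact norm_assemble_le (fun e => hKK' e) hR

/-- [folklore] UNWEIGHTED (uniform) entrywise discrepancies — what an OPERATOR-NORM tower increment gives entry by entry —
package with the loss `1 ∕ w₀` of the smallest weight: `|K e − K′ e| ≤ m`, `w₀ ≤ wt e` ⇒ `‖assemble K − assemble K′‖ ≤ m ∕ w₀`.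
(The loss is the price of reading a weighted-entry species from an unweighted currency; row O4-r decides per species.) -/
theorem norm_assemble_sub_le_of_uniform {K K' : E → ℂ} (h : FormatBounded F K) (h' : FormatBounded F K') {m w₀ : ℝ}
    (hm : 0 ≤ m) (hw₀ : 0 < w₀) (hw : ∀ e, w₀ ≤ F.wt e) (hKK' : ∀ e, ‖K e - K' e‖ ≤ m) :
    ‖assemble F K - assemble F K'‖ ≤ m / w₀ :=
  norm_assemble_sub_le h h' (div_nonneg hm hw₀.le) fun e =>
    calc ‖K e - K' e‖ ≤ m := hKK' e
      _ = m / w₀ * w₀ := (div_mul_cancel₀ m hw₀.ne').symm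
      _ ≤ m / w₀ * F.wt e := mul_le_mul_of_nonneg_left (hw e) (div_nonneg hm hw₀.le)

end Generic

/-! ## §2 The B13 entry type (the five operator species a (2.14)-term reads) and the B13 weights -/

/-- THE ENTRY TYPE of the step's operator datum: the five species of design Q1 (v0.2), the three Gaussian kernels carrying a
LOCALISATION SLOT `t : T` (the term's `Z₀` and `s∕σ`-resolution — instantiation data), the two potential read-outs indexed by
the field argument `x : Ω` and the localisation domain `Y : 𝒴`; `κ` = bond (B-variable) sites, `ι` = X-variable sites, as in
route P2's `TermDatum`.  A MODEL of what is read, not a construction of Bałaban's kernels. [folklore] -/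
inductive Species (T κ ι Ω 𝒴 : Type*)
  /-- entry `(a′, a″)` of the covariance `C^{(k)}(Z₀, σ)` at slot `t` (B13 (2.14)–(2.15) p. 15; P2's `kP`) -/
  | cov (t : T) (a' a'' : κ)
  /-- entry `(i, j)` of the kernel `A = C*Δ_k(σ)C` under the square root of `Γ_k` at slot `t` (p. 15; P2's `kA`) -/
  | deltaKer (t : T) (i j : ι)
  /-- entry `(a′, i)` of the constituent `L` of `Γ_k = L·A^{−1/2}` at slot `t` (P2's `kL`) -/
  | gammaConstituent (t : T) (a' : κ) (i : ι)
  /-- the quadratic-form kernel `Q(Y, B; b, b′)` of Lemma 2 (1.42) p. 11 at field argument `x` (P2's `kQ`) -/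
  | potQ (x : Ω) (Y : 𝒴) (b b' : κ)
  /-- the operator part of `𝐕″_k(Y, ·)` of (1.42) at field argument `x` (P2's `kR`) -/
  | potR (x : Ω) (Y : 𝒴)

/-- DATA (positivity only): the geometry fixing the B13 ENTRY FORMATS — a pseudo-distance `d` on sites, the site maps of the
two kinds of variables, the decay rate `δ` (print: `½δ₀` in (2.16) p. 16), the contour radii `τ(Y)` ((2.18) p. 16, nonzero),
the (2.19)-type weights `w(Y)·k(b, b′)` and the `𝐕″`-format `v(Y)` ((1.36) p. 9 ∕ (2.18)); the same letters as P2's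
`TermDatum`∕`Geometry`, with the positivity a norm needs. [folklore] -/
structure B13Weights (κ ι S 𝒴 : Type*) where
  /-- pseudo-distance between sites -/
  d : S → S → ℝ
  /-- sites of the X-variables -/
  p : ι → S
  /-- sites of the B-variables (bonds) -/
  q : κ → S
  /-- decay rate of the Gaussian-kernel formats -/
  δ : ℝ
  /-- contour radii `τ(Y)` of the potentials' interpolation -/
  τ : 𝒴 → ℂ
  /-- domain weight of the quadratic-form format -/
  w : 𝒴 → ℝ
  /-- bond-pair weight of the quadratic-form format -/
  kk : κ → κ → ℝ
  /-- the `𝐕″`-format weight -/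
  v : 𝒴 → ℝ
  τ_ne : ∀ Y, τ Y ≠ 0
  w_pos : ∀ Y, 0 < w Y
  kk_pos : ∀ b b', 0 < kk b b'
  v_pos : ∀ Y, 0 < v Y

namespace B13Weights

variable {T κ ι S Ω 𝒴 : Type*} (G : B13Weights κ ι S 𝒴)

/-- THE B13 ENTRY WEIGHTS (= the entry formats of P2's `LinearReadouts.Calibrated` with moduli `1`): `e^{−δ d(q a′, q a″)}` for
the covariance, `e^{−2δ d}` for the kernel under the square root and for the constituent, `w(Y)k(b, b′)∕|τ(Y)|` and
`v(Y)∕|τ(Y)|` for the two potential read-outs (the `|τ(Y)|⁻¹` because P2 calibrates `τ(Y)·read-out`). [folklore] -/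
def wt : Species T κ ι Ω 𝒴 → ℝ
  | .cov _ a' a'' => Real.exp (-(G.δ * G.d (G.q a') (G.q a'')))
  | .deltaKer _ i j => Real.exp (-(2 * G.δ * G.d (G.p i) (G.p j)))
  | .gammaConstituent _ a' i => Real.exp (-(2 * G.δ * G.d (G.q a') (G.p i)))
  | .potQ _ Y b b' => G.w Y * G.kk b b' / ‖G.τ Y‖
  | .potR _ Y => G.v Y / ‖G.τ Y‖

/-- [folklore] The B13 weights are positive. -/
theorem wt_pos (e : Species T κ ι Ω 𝒴) : 0 < G.wt (T := T) (Ω := Ω) e := by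
  cases e with
  | cov t a' a'' => exact Real.exp_pos _
  | deltaKer t i j => exact Real.exp_pos _
  | gammaConstituent t a' i => exact Real.exp_pos _
  | potQ x Y b b' => exact div_pos (mul_pos (G.w_pos Y) (G.kk_pos b b')) (norm_pos_iff.2 (G.τ_ne Y))
  | potR x Y => exact div_pos (G.v_pos Y) (norm_pos_iff.2 (G.τ_ne Y))

/-- THE B13 FORMAT on the species entry type. [folklore] -/
def format : Format (Species T κ ι Ω 𝒴) := ⟨G.wt, G.wt_pos⟩

/-- [folklore] The format's weights are `wt`. -/
@[simp] theorem format_wt (e : Species T κ ι Ω 𝒴) : (G.format : Format (Species T κ ι Ω 𝒴)).wt e = G.wt e := rfl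

end B13Weights

/-- DATA: the RAW (un-normalised) species of ONE run at ONE step, as the step reads them — THE NAMED PARAMETERS OF THE
INSTANTIATION.  Where the tree has the object (the covariance species at `U = 1`: row NE2's tower values) a reading plugs it
in (row O4-r); for the other four species at a background nothing is in the tree yet. [folklore] -/
structure RawSpecies (T κ ι Ω 𝒴 : Type*) where
  /-- the covariance kernels `C^{(k)}(Z₀, σ)` per slot -/
  cov : T → κ → κ → ℂ
  /-- the kernels under the square root per slot -/
  deltaKer : T → ι → ι → ℂ
  /-- the constituents `L` per slot -/
  gammaConstituent : T → κ → ι → ℂ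
  /-- the quadratic-form kernels `Q(Y, B; b, b′)` at field argument `x` -/
  potQ : Ω → 𝒴 → κ → κ → ℂ
  /-- the operator parts of `𝐕″_k(Y, ·)` at field argument `x` -/
  potR : Ω → 𝒴 → ℂ

/-- The raw kernel of a raw-species record, entry by entry. [folklore] -/
def RawSpecies.kernel {T κ ι Ω 𝒴 : Type*} (r : RawSpecies T κ ι Ω 𝒴) : Species T κ ι Ω 𝒴 → ℂ
  | .cov t a' a'' => r.cov t a' a''
  | .deltaKer t i j => r.deltaKer t i j
  | .gammaConstituent t a' i => r.gammaConstituent t a' i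
  | .potQ x Y b b' => r.potQ x Y b b'
  | .potR x Y => r.potR x Y

/-! ## §3 Non-vacuity: a two-entry toy -/

section Toy

/-- Toy format on two entries with weights `1` and `1/2`. [folklore] -/
def toyFormat : Format (Fin 2) := ⟨![1, 1 / 2], fun e => by fin_cases e <;> norm_num⟩

/-- [folklore] The toy kernel `(3, 1)` lies in the toy format ball of radius `3` (entry `1` against weight `1/2` costs `2`). -/
theorem toy_inFormat : InFormat toyFormat ![(3 : ℂ), 1] 3 := by
  intro e
  fin_cases e <;> norm_num [toyFormat]

/-- [folklore] Non-vacuity of the packaging: the assembled toy kernel has norm `≤ 3` and its raw entries are read back. -/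
example : ‖assemble toyFormat ![(3 : ℂ), 1]‖ ≤ 3 ∧ entry toyFormat (assemble toyFormat ![(3 : ℂ), 1]) 1 = 1 :=
  ⟨norm_assemble_le toy_inFormat (by norm_num), by rw [entry_assemble toy_inFormat.formatBounded]; rfl⟩

/-- [folklore] Non-vacuity of the rate packaging: two toy kernels differing by `(1/4, 1/8)` — i.e. by `1/4 ×` the weights —
are assembled into data at distance `≤ 1/4`. -/
example : ‖assemble toyFormat ![(3 : ℂ), 1] - assemble toyFormat ![(3 : ℂ) + 1 / 4, 1 + 1 / 8]‖ ≤ 1 / 4 :=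
  norm_assemble_sub_le toy_inFormat.formatBounded (formatBounded_of_finite _) (by norm_num) fun e => by
    fin_cases e <;> norm_num [toyFormat]

end Toy

end Summit.QuantumFields.BalabanUV.T4Continuum.B13OpDatum
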